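import Literature.Analysis.FluidPDE.NovackScalingLaws
import Literature.Analysis.FluidPDE.DuchonRobertUniformDefectOfEuler
import Literature.Analysis.FluidPDE.DuchonRobertSymmTestFieldProofs
import Literature.Analysis.FluidPDE.EyinkUniformDefectOfEuler
import Literature.Analysis.FluidPDE.EyinkUniformDefectTransverse
import HarnessLib

/-!
# Novack 2024, Theorem 1 (the 4/3 and 4/5 lines): assembly of the discharge

Topic: Analysis/FluidPDE, proofs for the named fact `Torus.novack2024_fourThirds_fourFifths`
(`Literature.Analysis.FluidPDE.NovackScalingLaws`: Novack 2024, Thm. 1, Euler case — for every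
weak Euler solution `(u, p)` on `[0,T] × T^d`, `d ≥ 2`, with `u ∈ L³`, `p ∈ L^{3/2}` and every
functional `D` with the local energy balance, the local 4/3 law and the local 4/5 law hold).

## Main results

* `Torus.hasFourThirdsLaw_energyFluxFunctional` (**proved, no named facts**): every distributional
  Euler solution `(u, p)` on `T^d × (0,T)` with `u ∈ L³_{t,x}`, `p ∈ L^{3/2}_{t,x}` satisfies the
  local 4/3 law with Duchon–Robert's energy flux functional
  `D(u,p)(ψ) = ∫₀ᵀ∫ ½|u|²∂ₜψ + (½|u|² + p)⟪u,∇ψ⟫` (`Torus.energyFluxFunctional`). Chain, all in the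
  tree: Duchon–Robert's cubic identity (`integral_kernelFlux_mul_eq_holds`) and tested momentum
  equation (`symmTestField_identity_holds`) ⇒ uniform Duchon–Robert defect
  (`hasUniformDuchonRobertDefect_of_steps`) ⇒ shell limit
  (`HasUniformDuchonRobertDefect.hasFourThirdsLaw`).
* `Torus.tendstoUniformlyOn_eyinkTransverse_of_balance`: granted Eyink's transverse balance at
  scale `ε` (named fact `Torus.eyink_transverse_balance`, Eyink 2003, (uuT-eq)), the transverse
  Eyink fluxes `∫₀ᵀ∫ D_T^{ε,φ}(u) ψ` converge to `D(u,p)(ψ)` uniformly over spherically symmetric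
  unit-ball mollifiers (the transverse half of `Torus.hasUniformEyinkDefect_of_eyinkBalance`,
  isolated so that the longitudinal balance is not needed: the proved uniform limit
  `eyinkBalanceT_sub_lt` of `EyinkBalanceLimits`).
* `Torus.novack2024_fourThirds_fourFifths_of_eyink_transverse_balance`: **Novack's Thm. 1 (I and L
  lines) from the single named fact `eyink_transverse_balance`** — the 4/3 law by the first bullet
  and transfer of the defect through the local energy balance (`HasFourThirdsLaw.congr_defect`),
  the 4/5 law from the 4/3 law and the uniform transverse limit
  (`HasFourThirdsLaw.hasFourFifthsLaw_of_uniformTransverse`, `EyinkUniformDefectTransverse`: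
  Eyink's (id-T) and a Volterra equation, no longitudinal balance). The unconditional
  `novack2024_fourThirds_fourFifths_holds` is then one line away from a discharge of
  `eyink_transverse_balance`.

Novack's hypotheses `u ∈ C⁰([0,T]; L²)`, `u₀ ∈ L²`, `0 < T` are not used by this route (they serve
the endpoint terms of his ball-averaged balance, `NovackBallAvgBalance`); the laws concern test
functions supported in `(0,T)`.

## References

* M. Novack, *Scaling laws and exact results in turbulence*, Nonlinearity 37 (2024) 095002 =
  arXiv:2310.01375, Thm. 1 and §2 (PDF pp. 4–9). [Novack2024]
* G. L. Eyink, *Local 4/5-law and energy dissipation anomaly in turbulence*, Nonlinearity 16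
  (2003) 137–145 = arXiv:nlin/0208004, §2, Thm. 1, (uuT-eq), (id-T). [Eyink2003]
* J. Duchon, R. Robert, Nonlinearity 13 (2000) 249–255, Prop. 2 and §4. [DuchonRobert2000]
-/

noncomputable section

open MeasureTheory TopologicalSpace Set Function Filter Topology Metric
open scoped InnerProductSpace RealInnerProductSpace ENNReal NNReal

namespace Literature.Analysis.FluidPDE.Torus

variable {d : Type*} [Fintype d]

section Assembly

variable {T : ℝ} {u : ℝ → UnitAddTorus d → EuclideanSpace ℝ d} {p : ℝ → UnitAddTorus d → ℝ}

/-- **The local 4/3 law for distributional Euler solutions, unconditionally.** For a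
distributional Euler solution `(u, p)` on `T^d × (0,T)` with `u ∈ L³_{t,x}`, `p ∈ L^{3/2}_{t,x}`,
the local 4/3 law holds with the energy flux functional `D(u,p)` as defect (Duchon–Robert 2000,
Prop. 2 and §4; Eyink 2003, (1.6); Novack 2024, Thm. 1, I-line): Duchon–Robert's cubic identity and
tested momentum equation (both discharged in the tree) give a uniform Duchon–Robert defect, which
yields the shell limit. [cite: Novack2024, Thm. 1] -/
theorem hasFourThirdsLaw_energyFluxFunctional [DecidableEq d]
    (hsol : IsDistributionalNSSolutionOn T 0 0 u p)
    (hu3 : ∫⁻ t in Ioo 0 T, ∫⁻ x, ‖u t x‖ₑ ^ (3 : ℕ) < ∞)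
    (hp : ∫⁻ t in Ioo 0 T, ∫⁻ x, ‖p t x‖ₑ ^ (3 / 2 : ℝ) < ∞) :
    HasFourThirdsLaw T u (energyFluxFunctional T u p) :=
  (hasUniformDuchonRobertDefect_of_steps integral_kernelFlux_mul_eq_holds
    symmTestField_identity_holds hsol hu3 hp).hasFourThirdsLaw hsol.1 hu3

/-- **Uniform transverse Eyink limit from the transverse balance.** Granted Eyink's scale-`ε`
transverse balance `eyink_transverse_balance` (Eyink 2003, (uuT-eq)), for a distributional Euler
solution `(u, p)` on `T^d × (0,T)`, `d ≥ 2`, with `u ∈ L³`, `p ∈ L^{3/2}`, the transverse fluxes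
`∫₀ᵀ∫ D_T^{ε,φ}(u) ψ` converge to `D(u,p)(ψ)` as `ε → 0⁺`, uniformly over spherically symmetric
unit-ball mollifiers `φ` (`∫∫ D_T^{ε,φ} ψ = (d/(4(d−1))) 𝓔_T^{ε,φ}(ψ)` by the fact, and
`𝓔_T^{ε,φ}(ψ) → (4(d−1)/d) D(u,p)(ψ)` uniformly, `eyinkBalanceT_sub_lt`). The transverse half of
`Torus.hasUniformEyinkDefect_of_eyinkBalance`. [cite: Eyink2003, §2 Thm. 1] -/
theorem tendstoUniformlyOn_eyinkTransverse_of_balance [DecidableEq d]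
    (hTr : eyink_transverse_balance (d := d)) (hd : 2 ≤ Fintype.card d)
    (hsol : IsDistributionalNSSolutionOn T 0 0 u p)
    (hu3 : ∫⁻ t in Ioo 0 T, ∫⁻ x, ‖u t x‖ₑ ^ (3 : ℕ) < ∞)
    (hp32 : ∫⁻ t in Ioo 0 T, ∫⁻ x, ‖p t x‖ₑ ^ (3 / 2 : ℝ) < ∞)
    {ψ : ℝ → UnitAddTorus d → ℝ} (hψ : FunctionSpaces.Torus.IsSpaceTimeTestIoo T ψ) :
    TendstoUniformlyOn
      (fun (ε : ℝ) (φ : EuclideanSpace ℝ d → ℝ) =>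
        ∫ t in Ioo 0 T, ∫ x, eyinkTransverseApprox φ ε (u t) x * ψ t x)
      (fun _ => energyFluxFunctional T u p ψ) (𝓝[>] 0) {φ | IsRadialUnitBallMollifier φ} := by
  haveI : Nonempty d := by
    by_contra h
    rw [not_nonempty_iff] at h
    have : Fintype.card d = 0 := Fintype.card_eq_zero
    omega
  have hn : (0 : ℝ) < Fintype.card d := by exact_mod_cast (show 0 < Fintype.card d by omega)
  have hn1 : (0 : ℝ) < (Fintype.card d : ℝ) - 1 := by
    have : (2 : ℝ) ≤ Fintype.card d := by exact_mod_cast hd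
    linarith
  refine Metric.tendstoUniformlyOn_iff.2 fun η hη => ?_
  obtain ⟨εT, hεT, hTlim⟩ := eyinkBalanceT_sub_lt (T := T) (u := u) (p := p) hsol.1 hu3 hsol.2.2.1
    hp32 hψ (η := 4 * ((Fintype.card d : ℝ) - 1) / Fintype.card d * η) (by positivity)
  filter_upwards [Ioo_mem_nhdsGT hεT] with ε hε φ hφ
  have hid := hTr hd hsol hu3 hp32 hφ.1.1 hφ.2 hε.1 hψ
  have hb := hTlim φ hφ.1 hφ.2 ε hε
  rw [Real.dist_eq, abs_sub_comm, energyFluxFunctional_apply]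
  -- `∫∫ D_T ψ = (d/(4(d-1))) 𝓔_T`
  have e : (∫ t in Ioo 0 T, ∫ x, eyinkTransverseApprox φ ε (u t) x * ψ t x) =
      (Fintype.card d : ℝ) / (4 * ((Fintype.card d : ℝ) - 1)) * eyinkBalanceT T u p φ ε ψ := by
    rw [hid]; field_simp
  rw [e]
  set I := ∫ t in Ioo 0 T, ∫ x, (2⁻¹ * ‖u t x‖ ^ 2 * FunctionSpaces.Torus.timeDeriv ψ t x +
    (2⁻¹ * ‖u t x‖ ^ 2 + p t x) * ⟪u t x, FunctionSpaces.Torus.gradient (ψ t) x⟫) with hI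
  set B := eyinkBalanceT T u p φ ε ψ with hB
  have hc : 0 < (Fintype.card d : ℝ) / (4 * ((Fintype.card d : ℝ) - 1)) := by positivity
  have hck : (Fintype.card d : ℝ) / (4 * ((Fintype.card d : ℝ) - 1)) *
      (4 * ((Fintype.card d : ℝ) - 1) / Fintype.card d) = 1 := by
    field_simp
  have e2 : (Fintype.card d : ℝ) / (4 * ((Fintype.card d : ℝ) - 1)) * B - I =
      (Fintype.card d : ℝ) / (4 * ((Fintype.card d : ℝ) - 1)) *
        (B - 4 * ((Fintype.card d : ℝ) - 1) / Fintype.card d * I) := by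
    linear_combination I * hck
  rw [e2, abs_mul, abs_of_pos hc]
  calc (Fintype.card d : ℝ) / (4 * ((Fintype.card d : ℝ) - 1)) *
        |B - 4 * ((Fintype.card d : ℝ) - 1) / Fintype.card d * I|
      < (Fintype.card d : ℝ) / (4 * ((Fintype.card d : ℝ) - 1)) *
        (4 * ((Fintype.card d : ℝ) - 1) / Fintype.card d * η) := by
        gcongr
    _ = η := by field_simp

/-- The local energy balance for Euler pins the defect on test functions supported in `(0,T)`:
`D ψ = D(u,p)(ψ)` (the viscous terms vanish for `ν = 0`). [folklore] -/
theorem HasLocalEnergyBalance.energyFluxFunctional_eq [DecidableEq d]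
    {G : ℝ → UnitAddTorus d → EuclideanSpace ℝ d →L[ℝ] EuclideanSpace ℝ d} {D : STFunctional d}
    (hbal : HasLocalEnergyBalance T 0 u p G D) {ψ : ℝ → UnitAddTorus d → ℝ}
    (hψ : FunctionSpaces.Torus.IsSpaceTimeTestIoo T ψ) :
    energyFluxFunctional T u p ψ = D ψ := by
  rw [energyFluxFunctional_apply, ← hbal.2 ψ hψ]
  refine setIntegral_congr_fun measurableSet_Ioo fun t _ => integral_congr_ae (ae_of_all _ fun x => ?_)
  simp only [mul_zero, zero_mul, add_zero, sub_zero]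

/-- **Novack 2024, Thm. 1 (4/3 and 4/5 lines), from Eyink's transverse balance alone.** Granted the
single named fact `Torus.eyink_transverse_balance` (Eyink 2003, (uuT-eq); all other printed steps
are discharged in the tree), the named fact `Torus.novack2024_fourThirds_fourFifths` holds: the 4/3
law unconditionally (`hasFourThirdsLaw_energyFluxFunctional`, transferred to the given defect `D`
through the local energy balance), and the 4/5 law from the 4/3 law and the uniform transverse
Eyink limit (`HasFourThirdsLaw.hasFourFifthsLaw_of_uniformTransverse`). [cite: Novack2024, Thm. 1] -/
theorem novack2024_fourThirds_fourFifths_of_eyink_transverse_balance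
    (hTr : ∀ [DecidableEq d], eyink_transverse_balance (d := d)) :
    novack2024_fourThirds_fourFifths (d := d) := by
  intro _ T _ u p hd _ hsol _ hu3 hp _ G D hbal
  have hdist := hsol.isDistributionalNSSolutionOn
  have hDD : ∀ ψ : ℝ → UnitAddTorus d → ℝ, FunctionSpaces.Torus.IsSpaceTimeTestIoo T ψ →
      energyFluxFunctional T u p ψ = D ψ := fun ψ hψ => hbal.energyFluxFunctional_eq hψ
  have h43 : HasFourThirdsLaw T u D :=
    (hasFourThirdsLaw_energyFluxFunctional hdist hu3 hp).congr_defect hDD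
  refine ⟨h43, h43.hasFourFifthsLaw_of_uniformTransverse hd (fun ψ hψ => ?_) hsol.1 hu3⟩
  rw [← hDD ψ hψ]
  exact tendstoUniformlyOn_eyinkTransverse_of_balance hTr hd hdist hu3 hp hψ

end Assembly

end Literature.Analysis.FluidPDE.Torus
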